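import Summits.Ventures.HodgeRepro.Tier4.Common.SL2BallFubini

/-!
# Tier4/Common/SL2BallGrowth — Haar measure of the `ℓ¹` balls in `SL(2, ℝ)` grows at most like `R² log R`

Blind re-derivation cell `pub-hodge-repro`, Tier 4 (README §9–§10), seat t4-typer-2 (gen 5).  Target tree path
`lean/Summits/Ventures/HodgeRepro/Tier4/Common/SL2BallGrowth.lean`.  Imports Mathlib + `Common.SL2BallFubini`
(+ `Common.SL2ConeMeasure`).  Module 3/3 of C-COMMON-SL2BALL stage A (bus S15425; plan-4 g5's plate line S15469) — the
statement of record of S15425, for EVERY Haar measure `μ` on `SL(2, ℝ)` and the `ℓ¹` entry norm `l1 a = ∑ i j, |a i j|`: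
* `coneMeasure_ball_le : coneMeasure (ball R) ≤ 16 R² (8 + 6 log (2R²))` for `R ≥ 1` (`SL2BallFubini`);
* **`haar_ball_le (μ) [IsHaarMeasure μ] : ∃ C ≥ 0, ∀ R ≥ 1, μ (ball R) ≤ ofReal (C · (R² · (8 + 6 log (2R²))))`**
  (`exists_eq_smul_coneMeasure`);
* **`haar_ball_le_rpow (μ) (hε : 0 < ε) : ∃ C ≥ 0, ∀ R ≥ 1, μ (ball R) ≤ ofReal (C · R^(2+ε))`** (`log_two_mul_sq_le`:
  `log (2R²) ≤ 2^(ε/2) R^ε / (ε/2)`);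
* **`haar_logBall_le_exp (μ) (hε : 0 < ε) : ∃ C ≥ 0, ∀ T ≥ 0, μ {a | log (max 1 (l1 a)) ≤ T} ≤ ofReal (C · exp ((2+ε) T))`**
  — the `log⁺`-coordinate form consumed by stage (B) (transport to the `w₀`-slice) and, through L4-p2's
  `archBallGrowth_of_slice` (C-L4-ARCHBALL-PRODUCT, S15470), by `ArchBallGrowth W μinf` with any `α = 2 + ε < 3`.

Nothing here says anything about the status of the Hodge conjecture for CM abelian varieties, which is NOT proved
(HC_CM is NOT proved by anyone in this repository).
-/

set_option autoImplicit false

noncomputable section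

open MeasureTheory Measure Set Function Topology
open scoped NNReal ENNReal Pointwise MatrixGroups

namespace Summit.Ventures.HodgeRepro.Tier4.Common

namespace SL2Ball

/-! ## 7. The ball bounds -/

/-- `log (2R²) ≤ 2^(ε/2) R^ε / (ε/2)` for `R ≥ 1`, `ε > 0` (the logarithm is beaten by any power). -/
theorem log_two_mul_sq_le {R ε : ℝ} (hR : 1 ≤ R) (hε : 0 < ε) :
    Real.log (2 * R ^ 2) ≤ (2 : ℝ) ^ (ε / 2) * R ^ ε / (ε / 2) := by
  have hR0 : 0 < R := by linarith
  have h2R : 0 < 2 * R ^ 2 := by positivity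
  have hδ : 0 < ε / 2 := by positivity
  have key : (ε / 2) * Real.log (2 * R ^ 2) ≤ (2 * R ^ 2) ^ (ε / 2) := by
    rw [← Real.log_rpow h2R]
    exact (Real.log_le_sub_one_of_pos (Real.rpow_pos_of_pos h2R _)).trans (by linarith)
  have hpow : (2 * R ^ 2) ^ (ε / 2) = (2 : ℝ) ^ (ε / 2) * R ^ ε := by
    rw [Real.mul_rpow (by norm_num) (by positivity), ← Real.rpow_natCast R 2, ← Real.rpow_mul hR0.le]
    congr 2
    push_cast
    ring
  rw [le_div_iff₀ hδ, mul_comm, ← hpow]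
  exact key

section Ball

variable [MeasurableSpace SL(2, ℝ)] [BorelSpace SL(2, ℝ)]

/-- `coneMeasure (ball R) ≤ 16 R² (8 + 6 log (2R²))` for `R ≥ 1`. -/
theorem coneMeasure_ball_le {R : ℝ} (hR : 1 ≤ R) :
    coneMeasure (ball R) ≤ ENNReal.ofReal (16 * R ^ 2 * (8 + 6 * Real.log (2 * R ^ 2))) := by
  have hR0 : 0 < R := by linarith
  rw [coneMeasure_apply (measurableSet_ball R)]
  calc volume (ρ ⁻¹' ball R ∩ D) ≤ volume (E' R) :=
        measure_mono ((preimage_ball_inter_D_subset R).trans (E_subset_E' R))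
    _ ≤ ENNReal.ofReal (4 * R) * ENNReal.ofReal (4 * R) *
          ∫⁻ x in Icc (-(2 * R)) (2 * R), ENNReal.ofReal (φ R x) := volume_E'_le hR0
    _ ≤ ENNReal.ofReal (4 * R) * ENNReal.ofReal (4 * R) * ENNReal.ofReal (8 + 6 * Real.log (2 * R ^ 2)) :=
        mul_le_mul_right (lintegral_φ_le hR) _
    _ = ENNReal.ofReal (16 * R ^ 2 * (8 + 6 * Real.log (2 * R ^ 2))) := by
        rw [← ENNReal.ofReal_mul (by positivity), ← ENNReal.ofReal_mul (by positivity)]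
        congr 1
        ring

/-- **Haar measure of the `ℓ¹` balls in `SL(2, ℝ)`**: for every Haar measure `μ` there is `C ≥ 0` with
`μ {a | ‖a‖₁ ≤ R} ≤ C · R² · (8 + 6 log (2R²))` for all `R ≥ 1`. -/
theorem haar_ball_le (μ : Measure SL(2, ℝ)) [IsHaarMeasure μ] :
    ∃ C : ℝ, 0 ≤ C ∧ ∀ R : ℝ, 1 ≤ R →
      μ (ball R) ≤ ENNReal.ofReal (C * (R ^ 2 * (8 + 6 * Real.log (2 * R ^ 2)))) := by
  obtain ⟨c, hc⟩ := exists_eq_smul_coneMeasure μ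
  refine ⟨16 * (c : ℝ), by positivity, fun R hR => ?_⟩
  rw [hc, Measure.smul_apply, ENNReal.smul_def, smul_eq_mul]
  calc (c : ℝ≥0∞) * coneMeasure (ball R)
      ≤ c * ENNReal.ofReal (16 * R ^ 2 * (8 + 6 * Real.log (2 * R ^ 2))) :=
        mul_le_mul_right (coneMeasure_ball_le hR) _
    _ = ENNReal.ofReal (16 * (c : ℝ) * (R ^ 2 * (8 + 6 * Real.log (2 * R ^ 2)))) := by
        rw [← ENNReal.ofReal_coe_nnreal, ← ENNReal.ofReal_mul (by positivity)]
        congr 1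
        ring

/-- **The ball bound with a power**: `μ {a | ‖a‖₁ ≤ R} ≤ C_ε R^(2+ε)` for `R ≥ 1`, for every `ε > 0`. -/
theorem haar_ball_le_rpow (μ : Measure SL(2, ℝ)) [IsHaarMeasure μ] {ε : ℝ} (hε : 0 < ε) :
    ∃ C : ℝ, 0 ≤ C ∧ ∀ R : ℝ, 1 ≤ R → μ (ball R) ≤ ENNReal.ofReal (C * R ^ (2 + ε)) := by
  obtain ⟨C, hC, h⟩ := haar_ball_le μ
  have hδ : 0 < ε / 2 := by positivity
  have h2 : 0 ≤ (2 : ℝ) ^ (ε / 2) / (ε / 2) := by positivity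
  refine ⟨C * (8 + 6 * ((2 : ℝ) ^ (ε / 2) / (ε / 2))), by positivity, fun R hR => ?_⟩
  have hR0 : 0 < R := by linarith
  refine (h R hR).trans (ENNReal.ofReal_le_ofReal ?_)
  have hlog := log_two_mul_sq_le hR hε
  have hRε : 1 ≤ R ^ ε := Real.one_le_rpow hR hε.le
  have hRadd : R ^ (2 + ε) = R ^ 2 * R ^ ε := by
    rw [Real.rpow_add hR0, Real.rpow_two]
  rw [hRadd]
  have hlog' : Real.log (2 * R ^ 2) ≤ (2 : ℝ) ^ (ε / 2) / (ε / 2) * R ^ ε := by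
    rw [div_mul_eq_mul_div]
    exact hlog
  have hR2 : 0 ≤ R ^ 2 := by positivity
  have hmain : R ^ 2 * (8 + 6 * Real.log (2 * R ^ 2)) ≤
      (8 + 6 * ((2 : ℝ) ^ (ε / 2) / (ε / 2))) * (R ^ 2 * R ^ ε) := by
    calc R ^ 2 * (8 + 6 * Real.log (2 * R ^ 2))
        ≤ R ^ 2 * (8 * R ^ ε + 6 * ((2 : ℝ) ^ (ε / 2) / (ε / 2) * R ^ ε)) := by
          apply mul_le_mul_of_nonneg_left _ hR2
          linarith
      _ = _ := by ring
  calc C * (R ^ 2 * (8 + 6 * Real.log (2 * R ^ 2)))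
      ≤ C * ((8 + 6 * ((2 : ℝ) ^ (ε / 2) / (ε / 2))) * (R ^ 2 * R ^ ε)) := mul_le_mul_of_nonneg_left hmain hC
    _ = _ := by ring

/-- **The ball bound in the `log⁺` coordinate**: `μ {a | log (max 1 ‖a‖₁) ≤ T} ≤ C_ε e^((2+ε) T)` for `T ≥ 0`. -/
theorem haar_logBall_le_exp (μ : Measure SL(2, ℝ)) [IsHaarMeasure μ] {ε : ℝ} (hε : 0 < ε) :
    ∃ C : ℝ, 0 ≤ C ∧ ∀ T : ℝ, 0 ≤ T →
      μ {a | Real.log (max 1 (l1 a)) ≤ T} ≤ ENNReal.ofReal (C * Real.exp ((2 + ε) * T)) := by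
  obtain ⟨C, hC, h⟩ := haar_ball_le_rpow μ hε
  refine ⟨C, hC, fun T hT => ?_⟩
  have hsub : {a | Real.log (max 1 (l1 a)) ≤ T} ⊆ ball (Real.exp T) := by
    intro a ha
    simp only [mem_setOf_eq] at ha
    have h1 : (0 : ℝ) < max 1 (l1 a) := lt_of_lt_of_le one_pos (le_max_left _ _)
    have hmax : max 1 (l1 a) ≤ Real.exp T := by
      rw [← Real.exp_log h1]
      exact Real.exp_le_exp.2 ha
    exact le_trans (le_max_right _ _) hmax
  refine (measure_mono hsub).trans ((h _ (Real.one_le_exp hT)).trans (le_of_eq ?_))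
  congr 1
  rw [Real.rpow_def_of_pos (Real.exp_pos T), Real.log_exp]
  congr 2
  ring

end Ball

end SL2Ball

end Summit.Ventures.HodgeRepro.Tier4.Common
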